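import Literature.AlgebraicGeometry.Motives.AbelianVarietyProjectiveOfCubeProofs
import Literature.AlgebraicGeometry.Motives.AbelianVarietyTheoremOfCubeProofs
import HarnessLib

/-!
# Abelian varieties are projective: the trust base after the decomposition of the Theorem of the Cube

The named fact `Literature.AlgebraicGeometry.Motives.AbelianVariety.isProjectiveOver` (Milne,
*Abelian Varieties* (1986), Thm. 7.1, p. 112: "Every abelian variety is projective"; Görtz–Wedhorn
II, Prop. 27.174; Mumford, *Abelian Varieties*, §6, Application 1) is reduced in
`Motives/AbelianVarietyProjectiveOfCubeProofs` (`AbelianVariety.isProjectiveOver_of_cube`) to the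
Theorem of the Cube `theoremOfCube_linEquiv` (Görtz–Wedhorn II, Thm. 24.73) alone, and the Theorem
of the Cube is reduced in `Motives/AbelianVarietyTheoremOfCubeProofs`
(`theoremOfCube_linEquiv_of_pseudoCoherent_of_stepI_of_fibre`) to three leaves, two of which are
meanwhile theorems: the descent of the fibre condition along the stages
(`trivialLocus_descendsAlongStages_holds`, `Motives/TheoremOfCubeLimitProofs`) and Step (I) of the
proof of Görtz–Wedhorn II, Lemma 24.72 (`theoremOfCube_trivialAlong_thickeningPt_holds`,
`Motives/CubeStepI`: `𝒪(D)` is trivial on all infinitesimal neighbourhoods of a fibre over a point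
of the trivial locus — induction along `𝒪_{T,t}/𝔪ⁿ⁺¹`, the obstruction class of a lift along a
small extension and the Künneth injectivity on the fibre); `Motives/AbelianVarietyTheoremOfCubeProofs`
feeds both in (`theoremOfCube_linEquiv_of_pseudoCoherent_general`). This file records the
composite, so that the trust base of the projectivity of abelian varieties is visible in one
place: it rests on exactly ONE named fact,

* `cechComplex_pseudoCoherent_general` (`Motives/GrothendieckComplexSectionAlongCech`;
  Görtz–Wedhorn II, Thm. 23.133 / Cor. 23.135: the Čech complex of `𝒪(D)` over an affine open of
  the base is pseudo-coherent — finiteness of coherent cohomology of proper morphisms),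

and its discharge `AbelianVariety.isProjectiveOver_holds` will be the one-liner
`isProjectiveOver_of_pseudoCoherent_general cechComplex_pseudoCoherent_general_holds` once that
leaf lands. (The earlier composites from two leaves, `theoremOfCube_linEquiv_of_pseudoCoherent_of_stepI`,
`AbelianVariety.isProjectiveOver_of_pseudoCoherent_of_stepI` and
`AbelianVariety.isSmoothProjective_of_pseudoCoherent_of_stepI`, which took Step (I) as a
hypothesis, have been removed: with Step (I) proved they merely restated
`theoremOfCube_linEquiv_of_pseudoCoherent_general` and the two theorems below with a vacuous extra
hypothesis.)

No new named fact is introduced; both theorems are compositions of proved reductions.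

## References

* J. S. Milne, *Abelian Varieties*, Ch. V of Cornell–Silverman (eds.), *Arithmetic Geometry*,
  Springer (1986): §7, Thm. 7.1 (p. 112), proof pp. 112–114 (read via the held copy).
  [Milne1986AbelianVarieties]
* U. Görtz, T. Wedhorn, *Algebraic Geometry II: Cohomology of Schemes*, Springer Spektrum (2023),
  doi:10.1007/978-3-658-43031-3: Thm. 23.133 and Cor. 23.135 (pp. 478–480), Lemma 24.72 and
  Thm. 24.73 (pp. 548–550), Prop. 27.174 (p. 880). [GortzWedhorn2023]
* D. Mumford, *Abelian Varieties* (1970): §6, Application 1, p. 62. [MumfordAV1970]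
-/

noncomputable section

universe u

open CategoryTheory AlgebraicGeometry

namespace Literature.AlgebraicGeometry.Motives

namespace AbelianVariety

/-- **Every abelian variety over every field is projective, granted the pseudo-coherence of the
Čech complex of `𝒪(D)`** (Milne, *Abelian Varieties* (1986), Thm. 7.1; Görtz–Wedhorn II,
Prop. 27.174): the named fact `AbelianVariety.isProjectiveOver` at the field `k` from the single
remaining named fact `cechComplex_pseudoCoherent_general` (Görtz–Wedhorn II, Thm. 23.133 /
Cor. 23.135), by `isProjectiveOver_of_cube` (`Motives/AbelianVarietyProjectiveOfCubeProofs`) and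
`theoremOfCube_linEquiv_of_pseudoCoherent_general` (`Motives/AbelianVarietyTheoremOfCubeProofs`,
which discharges Step (I) by `theoremOfCube_trivialAlong_thickeningPt_holds` and the fibre descent by
`trivialLocus_descendsAlongStages_holds`).
[cite: Milne1986AbelianVarieties, Thm. 7.1 (p. 112)] [cite: GortzWedhorn2023, Prop. 27.174 (p. 880) with Thm. 24.73 (p. 550) and Thm. 23.133 / Cor. 23.135 (pp. 478–480)] -/
theorem isProjectiveOver_of_pseudoCoherent_general {k : Type u} [Field k]
    (h : cechComplex_pseudoCoherent_general.{u}) : AbelianVariety.isProjectiveOver (k := k) :=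
  isProjectiveOver_of_cube (theoremOfCube_linEquiv_of_pseudoCoherent_general h)

/-- The named fact `A.isSmoothProjective` (`Motives/AbelianVariety`) for every abelian variety `A`
over every field, granted the pseudo-coherence of the Čech complex of `𝒪(D)` alone
(`isSmoothProjective_of_cube` with `theoremOfCube_linEquiv_of_pseudoCoherent_general`).
[cite: GortzWedhorn2023, Prop. 27.174 (p. 880) with Thm. 24.73 (p. 550)] -/
theorem isSmoothProjective_of_pseudoCoherent_general {k : Type u} [Field k] (A : AbelianVariety k)
    (h : cechComplex_pseudoCoherent_general.{u}) : A.isSmoothProjective :=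
  A.isSmoothProjective_of_cube (theoremOfCube_linEquiv_of_pseudoCoherent_general h)

end AbelianVariety

end Literature.AlgebraicGeometry.Motives

end
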